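/-
Copyright (c) 2026 the pub-hodgecm-mathlib formalisation cell (harness21).  Prover seat hodgecm-mathlib-K2E3-p28 (g2), HCML Track B «K2-LIT» ∕ h413
(`stmt-HodgeConjecture-24833`), R90-TF section S4 (Rogawski Ch. 13.1–13.2), DEAL WAVE S4-W4 «LI-G CHAIN» brick (W4-1) D-ALG (dealt BY NAME by the S4 dealer
K2E2-plan (g6), 2026-09-04T21:59:08Z; head of record HEADS-S4-W4 22:03:00Z).  2026-09-04.
-/
import Literature.Algebra.Module.TraceLinearIndependentSimpleModules   -- ★ `NoetherDeuring.exists_smul_eq_forall_of_isAlgClosed` (density, several blocks)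
import Mathlib.Algebra.FreeAlgebra
import Mathlib.Analysis.Complex.Polynomial.Basic
import HarnessLib

/-!
# R90-TF S4, brick (W4-1) D-ALG — simultaneous realisation of block endomorphisms by the free algebra (generator form of ★ density)

Cell `pub/hodgecm-mathlib` (D-0151), Track B (21-frontier RULING «PUSH BOTH» 2026-09-03, director req624), seat K2E3-p28 (g2), section S4 (dealer
K2E2-plan (g6)), DEAL WAVE S4-W4 «LI-G CHAIN» (RULING S4-R9).  `--supports stmt-HodgeConjecture-24833 --as helper`; THEOREMS ONLY (no definition ∕
instance ∕ notation ∕ named fact ∕ `sorry`); imports ★ `Literature.Algebra.Module.TraceLinearIndependentSimpleModules` + Mathlib; never imports `Cruxes/…/Lines`.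

THE STATEMENT (head of record, HEADS-S4-W4 22:03:00Z «ADOPTED VERBATIM»; instance-free; `k` any algebraically closed field, `k := ℂ` exported separately).
Let `ι` be finite, `W j` (`j : ι`) finite-dimensional `k`-spaces and `gen j : X → End_k (W j)` families of «generators» such that
* (i)  `hirr` — every `k`-subspace of `W j` stable under all `gen j x` is `⊥` or `⊤`;
* (ii) `hrig` — for `i ≠ j` every `k`-linear `φ : W i → W j` with `φ ∘ gen i x = gen j x ∘ φ` for all `x` is `0`.
Then EVERY family `F j : End_k (W j)` is realised SIMULTANEOUSLY: `∃ r : FreeAlgebra k X, ∀ j, FreeAlgebra.lift k (gen j) r = F j`.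

REUSE, NOT RE-PROOF.  The density theorem itself is ALREADY ★ in the tree: `Literature.Algebra.Module.NoetherDeuring.exists_smul_eq_forall_of_isAlgClosed`
(`Literature/Algebra/Module/TraceLinearIndependentSimpleModules.lean` :181 — Goodman–Wallach Lemma 4.1.18 (proof) ∕ Lam (7.3), via Mathlib's Jacobson density
`Module.Finite.toModuleEnd_moduleEnd_surjective`): for a finite family of pairwise non-isomorphic SIMPLE finite-dimensional modules over a `k`-algebra `A`,
`∀ F, ∃ a : A, ∀ i x, a • x = F i x`.  This file only TRANSLATES the generator currency of S4-W4 into that lemma's currency (≈ the glue the wave needs):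
* `A := FreeAlgebra k X` acts on `W j` through `FreeAlgebra.lift k (gen j)` (`Module.compHom`; `IsScalarTower k A (W j)` since the lift is `k`-linear);
* (i) ⇒ a NON-ZERO block is a simple `A`-module (an `A`-submodule is a `gen j`-stable `k`-subspace, `k ⊆ A` acting by the given scalars);
* (ii) ⇒ non-zero blocks with `i ≠ j` are not `A`-isomorphic (an `A`-linear equivalence restricts to a `k`-linear intertwiner, which is `0`);
* the ZERO blocks are dropped by restricting to `{j // Nontrivial (W j)}` (there `F j = 0 = FreeAlgebra.lift k (gen j) r` automatically) — so the head carries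
  no `Nontrivial` hypothesis.
CONSUMERS (S4-W4): (W4-3) D-REP supplies (i), (ii) for `W j := (ρ j).fixedPoints K`, `gen := levelActOp`; (W4-2) D-REAL realises `r` by a test function; (W4-5)
D-ASM assembles.  [cite: GoodmanWallachGTM255, §4.1.7 Lemma 4.1.18 (proof)] [cite: Lam2001FirstCourse, §7 (7.3)] (context; the cited content is the ★ import).
HONEST LABEL: pure linear algebra, proves nothing printed; HC_CM is proved only modulo the 7 printed citations (2 remaining named inputs: hLiu418 =
stmt-HodgeConjecture-24832, h413 = stmt-HodgeConjecture-24833) until rung 0 closes; count-neutral helper.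
-/

namespace Summit.HodgeConjecture.HodgeConjecture.R90.S4

open Module

/-- **(W4-1) D-ALG, general form — simultaneous realisation over an algebraically closed field** (generator form of ★
`NoetherDeuring.exists_smul_eq_forall_of_isAlgClosed`).  For finitely many finite-dimensional `k`-spaces `W j` with generator families
`gen j : X → End_k (W j)` that are block-wise irreducible (`hirr`) and pairwise rigid (`hrig`), every family of endomorphisms `F j` is
`FreeAlgebra.lift k (gen j) r` for ONE `r : FreeAlgebra k X`. [cite: GoodmanWallachGTM255, §4.1.7 Lemma 4.1.18 (proof)] -/
theorem exists_freeAlgebra_lift_eq_of_isAlgClosed (k : Type*) [Field k] [IsAlgClosed k]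
    {ι : Type*} [Finite ι] {X : Type*} {W : ι → Type*}
    [∀ j, AddCommGroup (W j)] [∀ j, Module k (W j)] [∀ j, FiniteDimensional k (W j)]
    (gen : ∀ j, X → Module.End k (W j))
    (hirr : ∀ j (p : Submodule k (W j)), (∀ x, ∀ w ∈ p, gen j x w ∈ p) → p = ⊥ ∨ p = ⊤)
    (hrig : ∀ i j, i ≠ j → ∀ φ : W i →ₗ[k] W j, (∀ x, φ ∘ₗ gen i x = gen j x ∘ₗ φ) → φ = 0)
    (F : ∀ j, Module.End k (W j)) :
    ∃ r : FreeAlgebra k X, ∀ j, FreeAlgebra.lift k (gen j) r = F j := by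
  classical
  cases nonempty_fintype ι
  /- `A := FreeAlgebra k X` acts on each block through `FreeAlgebra.lift k (gen j)`. -/
  letI instA : ∀ j, Module (FreeAlgebra k X) (W j) := fun j =>
    Module.compHom (W j) (FreeAlgebra.lift k (gen j)).toRingHom
  have smul_def : ∀ j (r : FreeAlgebra k X) (w : W j), r • w = FreeAlgebra.lift k (gen j) r w :=
    fun _ _ _ => rfl
  have smul_ι : ∀ j (x : X) (w : W j), FreeAlgebra.ι k x • w = gen j x w := fun j x w => by
    rw [smul_def, FreeAlgebra.lift_ι_apply]
  have smul_alg : ∀ j (c : k) (w : W j), algebraMap k (FreeAlgebra k X) c • w = c • w := fun j c w => by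
    rw [smul_def, AlgHom.commutes, Module.algebraMap_end_apply]
  haveI instT : ∀ j, IsScalarTower k (FreeAlgebra k X) (W j) := fun j =>
    ⟨fun c r w => by rw [smul_def, smul_def, map_smul, LinearMap.smul_apply]⟩
  /- (i) ⇒ a non-zero block is a simple `A`-module. -/
  have hsimple : ∀ j, Nontrivial (W j) → IsSimpleModule (FreeAlgebra k X) (W j) := by
    intro j hW
    rw [isSimpleModule_iff]
    refine { eq_bot_or_eq_top := fun p => ?_ }
    -- the `k`-subspace with the same carrier as the `A`-submodule `p`
    let q : Submodule k (W j) :=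
      { carrier := p
        add_mem' := fun ha hb => p.add_mem ha hb
        zero_mem' := p.zero_mem
        smul_mem' := fun c w hw => by
          have h := p.smul_mem (algebraMap k (FreeAlgebra k X) c) hw
          rw [smul_alg] at h
          exact h }
    have hq : ∀ x, ∀ w ∈ q, gen j x w ∈ q := fun x w hw => by
      have h := p.smul_mem (FreeAlgebra.ι k x) (show w ∈ p from hw)
      rw [smul_ι] at h
      exact h
    rcases hirr j q hq with h | h
    · refine Or.inl (eq_bot_iff.mpr fun w hw => ?_)
      have hw' : w ∈ q := hw
      rw [h] at hw'
      exact (Submodule.mem_bot (FreeAlgebra k X)).mpr ((Submodule.mem_bot k).mp hw')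
    · refine Or.inr (eq_top_iff.mpr fun w _ => ?_)
      have hw' : w ∈ q := by rw [h]; exact Submodule.mem_top
      exact hw'
  /- restrict to the non-zero blocks `ι' := {j // Nontrivial (W j)}`. -/
  haveI : ∀ j : {j : ι // Nontrivial (W j)}, IsSimpleModule (FreeAlgebra k X) (W j.1) := fun j => hsimple j.1 j.2
  /- (ii) ⇒ distinct non-zero blocks are not `A`-isomorphic. -/
  have hne : ∀ i j : {j : ι // Nontrivial (W j)}, Nonempty (W i.1 ≃ₗ[FreeAlgebra k X] W j.1) → i = j := by
    rintro ⟨i, hi⟩ ⟨j, hj⟩ ⟨e⟩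
    by_contra hij
    have hij' : i ≠ j := fun h => hij (Subtype.ext h)
    -- the underlying `k`-linear map of `e` intertwines the generators, hence vanishes by `hrig`
    let φ : W i →ₗ[k] W j :=
      { toFun := fun w => e w
        map_add' := fun a b => map_add e a b
        map_smul' := fun c w => by rw [RingHom.id_apply, ← smul_alg i c w, map_smul, smul_alg] }
    have hφ : ∀ x, φ ∘ₗ gen i x = gen j x ∘ₗ φ := fun x => by
      ext w
      simp only [LinearMap.coe_comp, Function.comp_apply, LinearMap.coe_mk, AddHom.coe_mk, φ]
      rw [← smul_ι i x w, map_smul, smul_ι]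
    have h0 : φ = 0 := hrig i j hij' φ hφ
    haveI := hi
    obtain ⟨w, hw⟩ := exists_ne (0 : W i)
    have hew : e w = 0 := by
      have h := LinearMap.congr_fun h0 w
      simpa only [LinearMap.coe_mk, AddHom.coe_mk, LinearMap.zero_apply, φ] using h
    exact hw (e.injective (by rw [hew, map_zero]))
  /- ★ density on the non-zero blocks. -/
  obtain ⟨r, hr⟩ := Literature.Algebra.Module.NoetherDeuring.exists_smul_eq_forall_of_isAlgClosed
    (k := k) (A := FreeAlgebra k X) (M := fun j : {j : ι // Nontrivial (W j)} => W j.1) hne (fun j => F j.1)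
  refine ⟨r, fun j => LinearMap.ext fun w => ?_⟩
  rcases subsingleton_or_nontrivial (W j) with hW | hW
  · exact Subsingleton.elim _ _
  · rw [← smul_def]
    exact hr ⟨j, hW⟩ w

/-- **(W4-1) D-ALG `exists_freeAlgebra_lift_eq` — simultaneous realisation over `ℂ`** (the S4-W4 head of record, HEADS-S4-W4 22:03:00Z): for
finitely many finite-dimensional `ℂ`-spaces `W j` with generator families `gen j : X → End_ℂ (W j)` such that (i) every `gen j`-stable subspace of
`W j` is `⊥` or `⊤` and (ii) for `i ≠ j` every `ℂ`-linear `φ : W i → W j` intertwining `gen` is `0`, EVERY family `F j : End_ℂ (W j)` is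
`FreeAlgebra.lift ℂ (gen j) r` for one `r : FreeAlgebra ℂ X`. [cite: GoodmanWallachGTM255, §4.1.7 Lemma 4.1.18 (proof)] -/
theorem exists_freeAlgebra_lift_eq {ι : Type*} [Finite ι] {X : Type*} {W : ι → Type*}
    [∀ j, AddCommGroup (W j)] [∀ j, Module ℂ (W j)] [∀ j, FiniteDimensional ℂ (W j)]
    (gen : ∀ j, X → Module.End ℂ (W j))
    (hirr : ∀ j (p : Submodule ℂ (W j)), (∀ x, ∀ w ∈ p, gen j x w ∈ p) → p = ⊥ ∨ p = ⊤)
    (hrig : ∀ i j, i ≠ j → ∀ φ : W i →ₗ[ℂ] W j, (∀ x, φ ∘ₗ gen i x = gen j x ∘ₗ φ) → φ = 0)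
    (F : ∀ j, Module.End ℂ (W j)) :
    ∃ r : FreeAlgebra ℂ X, ∀ j, FreeAlgebra.lift ℂ (gen j) r = F j :=
  exists_freeAlgebra_lift_eq_of_isAlgClosed ℂ gen hirr hrig F

end Summit.HodgeConjecture.HodgeConjecture.R90.S4
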